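import Summits.CriticalPhenomena.CardyFormulaZ2.Theorems.CardySelfDualSegmentUniformMarginalityDefs2
import Summits.CriticalPhenomena.CardyFormulaZ2.Theorems.CardySelfDualSegmentUniformMarginalityStubRussoIdentity
import Summits.CriticalPhenomena.CardyFormulaZ2.Theorems.CardySelfDualSegmentUniformMarginalityStubRussoIdentityEast
import Summits.CriticalPhenomena.CardyFormulaZ2.Theorems.CardySelfDualSegmentUniformMarginalityStubHeatFlowBalance

/-!
# The pivotal-balance identity (PB) of line `Sketch` (crux `UniformMarginality`, stmt-CriticalPhenomena-5472)

Registered sub-goal `stub_pivotalBalanceLattice : PivotalBalanceLattice` of the lead's line: the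
corrected pivotal-balance identity of `Theorems/CardySelfDualSegmentUniformMarginalityDefs2.lean`,

  `E_t[#Piv_lattice(A) ; Aᶜ] − E_t[#Piv_lattice(A) ; A] = 4 (1 − t) ∂_t P_t(R, δ)`

(exact, every conformal rectangle, every mesh, every `t ∈ (0,1)`; `A` the crude crossing event,
pivotal LATTICE edges only), assembled from the three landed exact identities — the Russo identity
(R) `stub_russoIdentity` (p98128), its east twin (R_E) `stub_russoIdentityEast` (p105326) and the
one-corner heat-flow balance (HF) `stub_heatFlowBalance` (p106648) — by the landed glue
`pivotalBalanceLattice_of` (Defs2, p103008). (The previous lead's proposal p107361 of this file was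
lost in a gate restart; this is its re-landing.) Consequence recorded in the line card: the crux in
Lipschitz form is EXACTLY "as many pivotal edges on `{no crossing}` as on `{crossing}`, up to
`O(1 − t)`".
-/

namespace Summit.CriticalPhenomena.CardyFormulaZ2.Cruxes.UniformMarginality.HeatFlow

/-- **(PB) — pivotal balance along the heat flow** (exact):
`E_t[#Piv_lattice ; Aᶜ] − E_t[#Piv_lattice ; A] = 4(1 − t) ∂_t P_t(R,δ)` for every conformal rectangle,
mesh `δ > 0` and `t ∈ (0,1)`; from (R), (R_E), (HF) by `pivotalBalanceLattice_of`. -/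
theorem stub_pivotalBalanceLattice : PivotalBalanceLattice :=
  pivotalBalanceLattice_of stub_russoIdentity stub_russoIdentityEast stub_heatFlowBalance

end Summit.CriticalPhenomena.CardyFormulaZ2.Cruxes.UniformMarginality.HeatFlow
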